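import Summits.HodgeConjecture.HodgeConjecture.Theorems.EndoscopicMiddleDegreeOrthogonalEnvelopedLevelDeepHecke
import Summits.HodgeConjecture.HodgeConjecture.Theorems.EndoscopicMiddleDegreeOrthogonalEnvelopedCoverMapHecke
import Summits.HodgeConjecture.HodgeConjecture.Theorems.EndoscopicMiddleDegreeOrthogonalEnvelopedDeepLevel
import Summits.HodgeConjecture.HodgeConjecture.Theorems.EndoscopicMiddleDegreeOrthogonalEnvelopedHeckeGraphAnalytic
import Literature.AlgebraicTopology.SingularHomology.FreeActionLefschetzNumber

/-!
# The Hecke ring of a compact ball quotient: products of Hecke operators are combinations of Hecke operators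
# (crux `EndoscopicMiddleDegree.OrthogonalEnveloped`, stmt-HodgeConjecture-14300, line `purity-sorted-hecke-envelope`, lead seat c6)

For the Hecke operators `T_g = [Γ ∩ g⁻¹Γg : N_g]⁻¹ τ ∘ π_g^*` of a compact ball quotient `X(ℂ) ≅ Γ \ 𝔹`
(`UnitaryBallQuotientDatum.heckeCorrespondenceAction`, Literature) we prove the multiplicativity half of the HECKE
RING (Shimura 1971, §3.1 Prop. 3.1, §3.4 (3.4.1)): `T_g T_h ∈ span_ℂ {T_y}` (`heckeMul_mem_span`), hence the Hecke
algebra `Algebra.adjoin ℂ {T_g}` is the span of the `T_g` (`adjoin_hecke_le_span`; it contains `1 = T_1`). The proof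
reads `T_g T_h` on a COMMON DEEP LEVEL `M ⊴ Γ` (`stub_exists_deepLevel`, landed): `π_M^*` is injective (finite Galois
covering, transfer: `map_proj_injective_of_card_ne_zero`), `π_M^* (T_g T_h x) = [Γ_g : M]⁻¹ Σ_{q ∈ Γ/M} q^* (π_g^M)^* (T_h x)`
(`stub_levelDeep_map_hecke`, landed), `(π_g^M)^* (T_h x) = [Γ_h : N_h]⁻¹ Σ_{q'} (π^M_{h γ_{q'} g})^* x`
(`stub_coverMap_map_hecke`, landed), and `Σ_q q^* (π^M_y)^* x = [Γ_y : M] π_M^* (T_y x)` (`stub_levelDeep_map_hecke`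
backwards) for each `y = h γ_{q'} g`; so `T_g T_h = Σ_{q'} c_{q'} T_{h γ_{q'} g}`. Consequence for the crux: every element of
the Hecke algebra — in particular every ℚ-block — is the action of an ALGEBRAIC self-correspondence
(`HeckeGraphChow.heckeGraphAlgebraic`, p111880, + linearity of `γ ↦ P_γ`), with no appeal to `CupProductAlgebraic`
(the registered stub `stub_cupTriple` of the line, = route item 14350, is thereby eliminated). References: Shimura 1971
§3.1, §3.3–3.4, §7.2–7.3; BMM arXiv:1306.1515 Part 2 §1.8; Hatcher §3.G.
-/

noncomputable section

-- The crux-workfile namespace `Summit.<P>.<Sub>.Cruxes.…` repeats `HodgeConjecture` (single-conjunct summit).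
set_option linter.dupNamespace false

namespace Summit.HodgeConjecture.HodgeConjecture.Cruxes.OrthogonalEnveloped.PuritySortedHeckeEnvelope

open scoped BigOperators
open Literature.AlgebraicGeometry.Motives (SchemeOver ComplexPoints IsSmoothProjective)
open Literature.AlgebraicGeometry.HodgeTheory
open Literature.AlgebraicGeometry.ShimuraVarieties
open Literature.AlgebraicTopology.SingularHomology
open Summit.HodgeConjecture.HodgeConjecture.Cruxes.OrthogonalEnveloped.HeckeGraphChow
  (stub_properlyDiscontinuous isCancelSMul_ball stub_ballLocallyCompactT2
    isHeckeAdmissible_of_mem_unitaryGroup stub_finiteIndexHeckeLevel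
    stub_levelCoveringOfProperlyDiscontinuous)

/-- **Products of Hecke operators are combinations of Hecke operators** (the Hecke ring; Shimura Prop. 3.1,
(3.4.1)): `T_g T_h ∈ span_ℂ {T_y}`. Read on a common deep level `M` (Stub H3; `π_M^*` injective by the transfer):
`π_M^* (T_g T_h x) = [Γ_g : M]⁻¹ Σ_{q ∈ Γ/M} q^* (π_g^M)^* (T_h x)` (Stub H1), `(π_g^M)^* (T_h x) =
[Γ_h : N_h]⁻¹ Σ_{q'} (π^M_{h γ_{q'} g})^* x` (Stub H2), and `Σ_q q^* (π^M_y)^* x = [Γ_y : M] π_M^* (T_y x)` (Stub H1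
backwards) for each `y = h γ_{q'} g`. [cite: Shimura1973, §3.1 Prop. 3.1 and §3.4 (3.4.1)] -/
theorem heckeMul_mem_span :
    ∀ {p : ℕ} {X : SchemeOver ℂ} (D : UnitaryBallQuotientDatum p X) (k : ℕ) (g h : GL (Fin (p + 1)) D.E),
      D.heckeCorrespondenceAction k g * D.heckeCorrespondenceAction k h ∈
        Submodule.span ℂ (Set.range (D.heckeCorrespondenceAction k)) := by
  intro p X D k g h
  classical
  by_cases hga : D.IsHeckeAdmissible g
  swap
  · rw [D.heckeCorrespondenceAction_of_not hga, zero_mul]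
    exact Submodule.zero_mem _
  by_cases hha : D.IsHeckeAdmissible h
  swap
  · rw [D.heckeCorrespondenceAction_of_not hha, mul_zero]
    exact Submodule.zero_mem _
  have hg := hga.mem_unitaryGroup
  have hh := hha.mem_unitaryGroup
  haveI : (D.heckeLevel h).FiniteIndex := hha.finiteIndex
  letI : Fintype (↥D.Γ ⧸ D.heckeLevel h) := Subgroup.fintypeQuotientOfFiniteIndex
  -- the ball is a locally compact Hausdorff space on which `Γ` acts freely and properly discontinuously
  haveI := stub_properlyDiscontinuous D
  haveI := isCancelSMul_ball D
  obtain ⟨hlc, ht2⟩ := stub_ballLocallyCompactT2 D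
  haveI := hlc
  haveI := ht2
  -- a section of `Γ → Γ / N_h` and a common deep level `M`
  set s : ↥D.Γ ⧸ D.heckeLevel h → ↥D.Γ := Quotient.out with hs_def
  have hs : ∀ q', (QuotientGroup.mk (s q') : ↥D.Γ ⧸ D.heckeLevel h) = q' := fun q' ↦
    QuotientGroup.out_eq' q'
  obtain ⟨M, hMn, hMf, hMg, hMle, hMh, hMy⟩ := stub_exists_deepLevel D g h hg hh s
  haveI := hMn
  haveI := hMf
  letI : Fintype (↥D.Γ ⧸ M) := Subgroup.fintypeQuotientOfFiniteIndex
  have hu : ∀ q', h * (s q' : GL (Fin (p + 1)) D.E) * g ∈ unitaryGroup (conjRingHom D.E) D.H :=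
    fun q' ↦ mul_mem (mul_mem hh (D.isCongruenceSubgroup.1 (s q').2)) hg
  have hc : ∀ q', ∀ γ ∈ M, h * (s q' : GL (Fin (p + 1)) D.E) * g * (γ : GL (Fin (p + 1)) D.E) *
      (h * (s q' : GL (Fin (p + 1)) D.E) * g)⁻¹ ∈ D.Γ :=
    fun q' γ hγ ↦ D.conj_mem_of_mem_heckeLevel _ (hMy q' hγ)
  -- the level-`M` projection is a finite Galois covering, so `π_M^*` is injective
  have hcov : IsCoveringMap (D.levelProj M) := stub_levelCoveringOfProperlyDiscontinuous D M
  have hinj : Function.Injective (singularCohomology.map ℂ ℂ (D.levelProj M) k) :=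
    (D.levelDeckCover M hcov).map_proj_injective_of_card_ne_zero ℂ
      (Nat.cast_ne_zero.2 Fintype.card_ne_zero) k
  -- the indices `[Γ_y : M]` are non-zero
  have hr : ∀ (y : GL (Fin (p + 1)) D.E), M ≤ D.heckeLevel y →
      (M.relIndex (D.heckeStabilizer y) : ℂ) ≠ 0 := by
    intro y hy
    have hle : M ≤ D.heckeStabilizer y := hy.trans (D.heckeLevel_le y)
    exact Nat.cast_ne_zero.2 (ne_zero_of_dvd_ne_zero Subgroup.FiniteIndex.index_ne_zero
      (Subgroup.relIndex_dvd_index_of_le hle))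
  -- the coefficients of the expansion
  set c : (↥D.Γ ⧸ D.heckeLevel h) → ℂ := fun q' ↦
    ((M.relIndex (D.heckeStabilizer g) : ℂ)⁻¹) * ((D.heckeIndex h : ℂ)⁻¹) *
      (M.relIndex (D.heckeStabilizer (h * (s q' : GL (Fin (p + 1)) D.E) * g)) : ℂ) with hc_def
  -- the expansion `T_g T_h = Σ_{q'} c_{q'} T_{h γ_{q'} g}`
  have key : D.heckeCorrespondenceAction k g * D.heckeCorrespondenceAction k h =
      ∑ q' : ↥D.Γ ⧸ D.heckeLevel h,
        c q' • D.heckeCorrespondenceAction k (h * (s q' : GL (Fin (p + 1)) D.E) * g) := by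
    refine LinearMap.ext fun x ↦ hinj ?_
    rw [Module.End.mul_apply, LinearMap.sum_apply, map_sum,
      stub_levelDeep_map_hecke D g hg M hMle hMg k (D.heckeCorrespondenceAction k h x)]
    -- expand each `(π_g^M ∘ q)^* (T_h x)` by Stub H2
    have h2 : ∀ q : ↥D.Γ ⧸ M,
        singularCohomology.map ℂ ℂ ((D.coverMap g hg hMg).comp
            ⟨fun e : D.LevelCover M ↦ q • e, continuous_const_smul q⟩) k
          (D.heckeCorrespondenceAction k h x) =
        ((D.heckeIndex h : ℂ)⁻¹) • ∑ q' : ↥D.Γ ⧸ D.heckeLevel h,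
          singularCohomology.map ℂ ℂ
            ((D.coverMap (N := M) (h * (s q' : GL (Fin (p + 1)) D.E) * g) (hu q') (hc q')).comp
              ⟨fun e : D.LevelCover M ↦ q • e, continuous_const_smul q⟩) k x := by
      intro q
      rw [singularCohomology.map_comp, ModuleCat.comp_apply,
        stub_coverMap_map_hecke D g h hg hh M hMg hMh s hs hu hc k x, map_smul, map_sum]
      congr 1
      refine Finset.sum_congr rfl fun q' _ ↦ ?_
      rw [singularCohomology.map_comp, ModuleCat.comp_apply]
    simp_rw [h2]
    rw [← Finset.smul_sum, Finset.sum_comm, Finset.smul_sum, Finset.smul_sum]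
    refine Finset.sum_congr rfl fun q' _ ↦ ?_
    -- re-assemble `Σ_q (π^M_y ∘ q)^* x = [Γ_y : M] • π_M^* (T_y x)` by Stub H1 for `y = h γ_{q'} g`
    rw [LinearMap.smul_apply, map_smul,
      stub_levelDeep_map_hecke D _ (hu q') M (hMy q') (hc q') k x, smul_smul, smul_smul, hc_def]
    congr 1
    simp only
    field_simp [hr _ (hMy q'), hr g hMle]
  rw [key]
  exact Submodule.sum_mem _ fun q' _ ↦ Submodule.smul_mem _ _ (Submodule.subset_span ⟨_, rfl⟩)

/-- **The Hecke algebra is the span of the Hecke operators**: `Algebra.adjoin ℂ {T_g} ⊆ span_ℂ {T_g}` — the span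
contains `1 = T_1` (`heckeCorrespondenceAction_one`) and is closed under products (`heckeMul_mem_span` and
bilinearity). [cite: Shimura1973, §3.1 Prop. 3.1 and §3.3] -/
theorem adjoin_hecke_le_span :
    ∀ {p : ℕ} {X : SchemeOver ℂ} (D : UnitaryBallQuotientDatum p X) (k : ℕ) {a : Module.End ℂ (complexBetti X k)},
      a ∈ Algebra.adjoin ℂ (Set.range (D.heckeCorrespondenceAction k)) →
        a ∈ Submodule.span ℂ (Set.range (D.heckeCorrespondenceAction k)) := by
  intro p X D k a ha
  let S : Subalgebra ℂ (Module.End ℂ (complexBetti X k)) :=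
    { carrier := Submodule.span ℂ (Set.range (D.heckeCorrespondenceAction k))
      mul_mem' := by
        intro a b ha hb
        change a * b ∈ Submodule.span ℂ (Set.range (D.heckeCorrespondenceAction k))
        have key : ∀ b ∈ Submodule.span ℂ (Set.range (D.heckeCorrespondenceAction k)),
            a * b ∈ Submodule.span ℂ (Set.range (D.heckeCorrespondenceAction k)) := by
          induction ha using Submodule.span_induction with
          | mem T hT =>
            intro b hb
            obtain ⟨g, rfl⟩ := hT
            induction hb using Submodule.span_induction with
            | mem T' hT' =>
              obtain ⟨h, rfl⟩ := hT'
              exact heckeMul_mem_span D k g h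
            | zero => rw [mul_zero]; exact Submodule.zero_mem _
            | add c d _ _ ihc ihd => rw [mul_add]; exact Submodule.add_mem _ ihc ihd
            | smul r c _ ihc => rw [mul_smul_comm]; exact Submodule.smul_mem _ r ihc
          | zero => intro b _; rw [zero_mul]; exact Submodule.zero_mem _
          | add c d _ _ ihc ihd =>
            intro b hb
            rw [add_mul]
            exact Submodule.add_mem _ (ihc b hb) (ihd b hb)
          | smul r c _ ihc =>
            intro b hb
            rw [smul_mul_assoc]
            exact Submodule.smul_mem _ r (ihc b hb)
        exact key b hb
      one_mem' := by
        change (1 : Module.End ℂ (complexBetti X k)) ∈ Submodule.span ℂ (Set.range (D.heckeCorrespondenceAction k))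
        rw [← D.heckeCorrespondenceAction_one k]
        exact Submodule.subset_span ⟨1, rfl⟩
      add_mem' := by
        intro a b ha hb
        exact Submodule.add_mem _ ha hb
      zero_mem' := Submodule.zero_mem _
      algebraMap_mem' := fun r ↦ by
        change algebraMap ℂ (Module.End ℂ (complexBetti X k)) r ∈
          Submodule.span ℂ (Set.range (D.heckeCorrespondenceAction k))
        rw [Algebra.algebraMap_eq_smul_one, ← D.heckeCorrespondenceAction_one k]
        exact Submodule.smul_mem _ r (Submodule.subset_span ⟨1, rfl⟩) }
  have hle : Algebra.adjoin ℂ (Set.range (D.heckeCorrespondenceAction k)) ≤ S :=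
    Algebra.adjoin_le fun T hT ↦ Submodule.subset_span hT
  exact hle ha

end Summit.HodgeConjecture.HodgeConjecture.Cruxes.OrthogonalEnveloped.PuritySortedHeckeEnvelope

end
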